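import Literature.MathematicalPhysics.StatisticalMechanics.CubicLatticeEdgeIsoperimetry
import HarnessLib

/-!
# The slicing recursion for the edge-isoperimetric problem in `ℤ^d`
# (Mainini–Schmidt 2020, Proposition 3.2; Agnarsson–Lauria 2013, §2–§4 and Observation 6.1)

Topic `Literature/MathematicalPhysics/StatisticalMechanics`; continues `EIPMinimizerSections.lean`
(the rearrangement of the slices of `A ⊂ ℤ^{n+1}` by a nested family of `EIP^n` minimizers) and
`CubicLatticeEdgeIsoperimetry.lean` (nested solutions in `ℤ³`).  Everything here is PROVED; no named
facts are introduced.  Purpose: the GEOMETRIC half of the general-dimension edge-isoperimetric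
theorem (Ahlswede–Bezrukov / Agnarsson–Lauria, = [MS20] Theorem 2.2, the content behind the vendored
`∀ d` facts of `EdgeIsoperimetricFluctuations.lean`), done once and for all dimensions, so that what
remains of that theorem is arithmetic on profiles (the "pseudo-cubic representation" of [AL13] §5–§6).

## What is proved (namespace `Literature.MathematicalPhysics.StatisticalMechanics`)

* `eipValue d n` — the VALUE `EIP^d(n) = min {#Θ_d(C) : C ⊂ ℤ^d, #C = n}` of [MS20] §1 as a function,
  with `eipValue_le`, `exists_card_boundaryPairs_eq_eipValue`, `isEIPMinimizer_iff_eipValue`,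
  `IsNestedMinimizerFamily.card_boundaryPairs` (`#Θ_n(D m) = EIP^n(m)`).
* **Lower bound by slicing** (`two_mul_card_sliceAt_add_sum_eipValue_le`): for every finite
  `A ⊂ ℤ^{n+1}` and every height `t`,
  `2·#A_t + Σ_{t'} EIP^n(#A_{t'}) ≤ #Θ_{n+1}(A)` — [MS20] Proposition 3.2 (horizontal bonds slice by
  slice, vertical bonds `≥ 2·max_t #A_t`) = [AL13] Observation 3.1 / §4 for arbitrary (not necessarily
  nested) sets.
* **Sorted family stacks in every dimension** (`famStack D f T`, generalising the `ℤ² → ℤ³`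
  `familyStack` of `CubicLatticeEdgeIsoperimetry.lean`): the members `D(f k)` of a nested family of
  `EIP^n` minimizers stacked in the hyperplanes `x₀ = k`, `k < T`, for a non-increasing profile `f`;
  `card_famStack`, `card_boundaryPairs_famStack` (`= 2·f(0) + Σ_{k<T} EIP^n(f k)`) — this is the
  *decreasing rearrangement* `C_s` of [MS20] Proposition 3.2 INCLUDING the reordering of the levels.
* **The sorted profile of a set** (`exists_sortedProfile`): the slice cardinalities of `A` listed in
  non-increasing order as a profile `f` with `Σ f = #A` and `2 f(0) + Σ EIP^n(f k) ≤ #Θ(A)`.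
* **The recursion** ([MS20] Prop. 3.2 ⇒; [AL13] §4): given a nested family in `ℤ^n`,
  `EIP^{n+1}(N) = min {2·max f + Σ_k EIP^n(f k) : f a profile (partition) of N}` —
  `eipValue_succ_le_profileCost` (every profile is realised by its sorted stack) and
  `exists_profileCost_eq_eipValue_succ` (the minimum is attained by the sorted profile of a minimizer);
  `isEIPMinimizer_famStack_of_cost` (a sorted stack with an optimal profile is a minimizer).
* **Lifting nested families** (`isNestedMinimizerFamily_famStack_of_chain`): a chain of optimal
  profiles `e N ≤ e (N+1)` (pointwise) over a nested family in `ℤ^n` gives a nested family of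
  `EIP^{n+1}` minimizers — the form in which [AL13] Proposition 5.7 (`⟦n⟧^d ⊆ ⟦n'⟧^d`) and [MS20]
  Theorem 2.9 (daisies are nested, their sections are daisies) produce nested solutions dimension by
  dimension.
* **[AL13] Lemma 4.1 / eq. (rec-exact2) in sharp boundary form, for arbitrary sets**
  (`eipValue_sub_add_eipValue_le_card_boundaryPairs`): `EIP^{n+1}(#A − #A_t) + EIP^n(#A_t) ≤ #Θ(A)` for
  every slice `A_t` of every finite `A ⊂ ℤ^{n+1}` (in boundary terms the printed `+ n₂` and the
  nestedness hypothesis disappear), and for sections in every direction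
  (`eipValue_sub_add_eipValue_le_of_latticeSection`).
* **[AL13] Observation 6.1** (`exists_latticeSection_card_mul_le`): a finite `A ⊂ ℤ^{n+1}` with more
  than `m^{n+1}` points has, in some direction, at least `m + 1` non-empty sections, hence a non-empty
  section with `#S·(m+1) ≤ #A`.
* The values `eipValue_one/_two/_three` (`2`, `2⌈2√m⌉`, `2G₃(m)`), the unconditional recursion
  `ℤ³ → ℤ⁴` over the cubicles of `ℤ³` (`eipValue_four_le`, `exists_profile_eipValue_four`,
  `isNestedMinimizerFamily_four_of_chain`: what remains of nested solutions in `ℤ⁴` is arithmetic), and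
  the corrected reduction `MaininiSchmidt2020_cor33_of_nested'` of the `∀ d` fact
  `MaininiSchmidt2020_cor33` to nested families in `ℤ^n` for `n ≥ 1` only (the hypothesis of
  `MaininiSchmidt2020_cor33_of_nested` in `EIPMinimizerSections.lean` also asks for `n = 0`, where
  `ℤ⁰` is a point and no such family exists; in `ℤ⁰`-valued sections every set is a minimizer,
  `isEIPMinimizer_site_zero`).

## Sources

**[MS20]** E. Mainini, B. Schmidt, *Maximal fluctuations around the Wulff shape for edge-isoperimetric
sets in ℤ^d: a sharp scaling law*, Comm. Math. Phys. 380 (2020) 947–971 = arXiv:2003.01679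
[MaininiSchmidt2020] (store key `paper:arxiv-2003.01679`, tex chunk p0009): Proposition 3.2 ("Let
`D^{(d−1)}_{s,k}` be the `(d−1)`-dimensional daisy with the same cardinality as `S_{s,k}(C)`.  Finally,
let `C_s ⊂ ℤ^d` denote the decreasing rearrangement of `C` in the `e_s` direction … Then
`#Θ_d(C_s) ≤ #Θ_d(C)`"), whose proof counts `Σ_k #Θ_{d−1}(S_{s,k})` horizontal bonds and
`≥ Σ |f(k_i) − f(k_{i−1})|`-type vertical bonds; Theorem 2.2 (nested special solutions,
[Ahlswede–Bezrukov 1995]).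
**[AL13]** G. Agnarsson, K. Lauria, *Extremal subgraphs of the d-dimensional grid graph*,
arXiv:1302.6517 [AgnarssonLauria2013] (store key `paper:arxiv-1302.6517`): Observation 3.1
(`E_d(S) = dn − Σ_i n_î` for fully nested `S`), §4 eq. (rec-exact1)/(rec-exact2) and Lemma 4.1
(`E_d(n) ≤ E_d(n₁) + E_{d−1}(n₂) + n₂` for the cut of an optimal fully nested set below its top side),
Observation 6.1 (`min_i A_i ≤ n/(m_d+1)` from `n ≥ h_i A_i` and `m_d^d < n < h_1⋯h_d`), Proposition 5.7
(cubicles are nested).  The two original sources of the theorem (Ahlswede–Bezrukov, Appl. Math.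
Lett. 8 (1995); Bollobás–Leader, Combinatorica 11 (1991)) are not held (acq-12942, acq-12965).
Conversion between the sources' induced-edge count `E` and the tree's `#Θ`: `#Θ_d + 2E = 2d·#C`
(`card_boundaryPairs_add_card_adjPairs`), so "`E` maximal" = "`#Θ` minimal" and every identity of
[AL13] is used here in its boundary form.

WHAT IS NOT HERE: the arithmetic half of [AL13] (pseudo-cubic representations, the cubicles `⟦n⟧^d`
for `d ≥ 4`, `F_d`, the induction of §5–§6 and Theorem 6.4), hence no nested family in `ℤ^d` for
`d ≥ 4` yet and the `∀ d` facts of `EdgeIsoperimetricFluctuations.lean` remain facts; gravity /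
fully nested sets ([AL13] §2) are not needed in the boundary formulation and are not formalised.
-/

noncomputable section

open Finset

namespace Literature.MathematicalPhysics.StatisticalMechanics

open Literature.Probability.LatticeModels

/-! ### The value function `EIP^d(n)` -/

section Value

variable {d : ℕ}

/-- **`EIP^d(n) := min {#Θ_d(C) : C ⊂ ℤ^d, #C = n}`**, the edge-isoperimetric profile of `ℤ^d` as a
function of the cardinality (for `d = 0` and `n ≥ 2` there is no such `C` and the junk value is `0`).
[cite: MaininiSchmidt2020, §1 (EIP^d(n) := min{#Θ_d(C) : C ⊂ ℤ^d, #C = n})] -/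
def eipValue (d n : ℕ) : ℕ :=
  sInf {v : ℕ | ∃ C : Finset (Site d), #C = n ∧ #(boundaryPairs C) = v}

/-- `EIP^d(#C) ≤ #Θ_d(C)` for every finite `C ⊂ ℤ^d`. [cite: MaininiSchmidt2020, §1 (definition of EIP^d(n))] -/
theorem eipValue_le (C : Finset (Site d)) : eipValue d #C ≤ #(boundaryPairs C) :=
  Nat.sInf_le ⟨C, rfl, rfl⟩

/-- The minimum defining `EIP^d(n)` is attained as soon as some `n`-point set exists (e.g. by `C`
itself for `n = #C`). [cite: MaininiSchmidt2020, §1 (EIP^d(n) is a minimum)] -/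
theorem exists_card_boundaryPairs_eq_eipValue (C : Finset (Site d)) :
    ∃ C' : Finset (Site d), #C' = #C ∧ #(boundaryPairs C') = eipValue d #C := by
  have hne : {v : ℕ | ∃ C' : Finset (Site d), #C' = #C ∧ #(boundaryPairs C') = v}.Nonempty :=
    ⟨_, C, rfl, rfl⟩
  obtain ⟨C', hC', hv⟩ := Nat.sInf_mem hne
  exact ⟨C', hC', hv⟩

/-- **`C` is an `EIP^d` minimizer iff `#Θ_d(C) = EIP^d(#C)`** — the printed definition of a minimizer.
[cite: MaininiSchmidt2020, §1 ("a nonempty set C is an EIP^d minimizer if #Θ_d(C) = EIP^d(#C)")] -/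
theorem isEIPMinimizer_iff_eipValue {C : Finset (Site d)} :
    IsEIPMinimizer C ↔ #(boundaryPairs C) = eipValue d #C := by
  constructor
  · intro h
    obtain ⟨C', hC', hv⟩ := exists_card_boundaryPairs_eq_eipValue C
    exact le_antisymm (hv ▸ h C' hC') (eipValue_le C)
  · intro h C' hC'
    rw [h, ← hC']
    exact eipValue_le C'

/-- A minimizer with `n` points has edge perimeter `EIP^d(n)`. [cite: MaininiSchmidt2020, §1] -/
theorem IsEIPMinimizer.card_boundaryPairs_eq {C : Finset (Site d)} (hC : IsEIPMinimizer C) {n : ℕ}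
    (hn : #C = n) : #(boundaryPairs C) = eipValue d n := by
  rw [← hn]; exact isEIPMinimizer_iff_eipValue.1 hC

/-- `EIP^d(0) = 0` (the empty set). [cite: MaininiSchmidt2020, §1 (the empty set is a minimizer by convention)] -/
theorem eipValue_zero_right (d : ℕ) : eipValue d 0 = 0 := by
  have h := eipValue_le (∅ : Finset (Site d))
  rw [card_empty] at h
  have h0 : #(boundaryPairs (∅ : Finset (Site d))) = 0 := by
    rw [card_eq_zero]
    exact eq_empty_of_forall_notMem fun u hu => by simp [mem_boundaryPairs] at hu
  omega

/-- The members of a nested family of minimizers realise the value function: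
`#Θ_n(D m) = EIP^n(m)`. [cite: MaininiSchmidt2020, Theorem 2.2 (the first n elements of ≺ form an EIP^d minimizer)] -/
theorem IsNestedMinimizerFamily.card_boundaryPairs {n : ℕ} {D : ℕ → Finset (Site n)}
    (hD : IsNestedMinimizerFamily D) (m : ℕ) : #(boundaryPairs (D m)) = eipValue n m :=
  (hD.isEIPMinimizer m).card_boundaryPairs_eq (hD.card_eq m)

/-- In `ℤ⁰` (a single point, no lattice directions) every configuration has edge perimeter `0`, so
every configuration is a minimizer — the degenerate bottom of the induction on the dimension.
[cite: MaininiSchmidt2020, §1 (definition of EIP^d minimizers)] -/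
theorem isEIPMinimizer_site_zero (C : Finset (Site 0)) : IsEIPMinimizer C := by
  intro C' _
  have h : ∀ A : Finset (Site 0), boundaryPairs A = ∅ := fun A =>
    eq_empty_of_forall_notMem fun u _ => u.2.1.elim0
  rw [h C, h C']

end Value

/-! ### The lower bound by slicing ([MS20] Proposition 3.2, [AL13] Observation 3.1 / §4) -/

section LowerBound

variable {n : ℕ} (A : Finset (Site (n + 1)))

/-- **`2·#A_t + Σ_{t'} EIP^n(#A_{t'}) ≤ #Θ_{n+1}(A)`** for every finite `A ⊂ ℤ^{n+1}` and every height
`t`: the boundary pairs in the directions `±e₁, …, ±e_n` are boundary pairs of the slices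
(`≥ Σ EIP^n(#A_{t'})`), and every vertical line meeting `A` — there are `#(dropFirst A) ≥ #A_t` of
them — carries an upward and a downward pair.  This is the counting in the proof of [MS20]
Proposition 3.2 (for arbitrary, not rearranged, `C`) and [AL13] Observation 3.1 + eq. (rec-exact1)
in boundary form. [cite: MaininiSchmidt2020, Proposition 3.2 (proof); AgnarssonLauria2013, Observation 3.1] -/
theorem two_mul_card_sliceAt_add_sum_eipValue_le (t : ℤ) :
    2 * #(sliceAt A t) + ∑ t' ∈ firstCoords A, eipValue n #(sliceAt A t') ≤ #(boundaryPairs A) := by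
  have h1 := sum_card_boundaryPairs_sliceAt_add_le (A := A)
  have h2 := card_sliceAt_le_card_dropFirst (A := A) t
  have h3 : ∑ t' ∈ firstCoords A, eipValue n #(sliceAt A t') ≤
      ∑ t' ∈ firstCoords A, #(boundaryPairs (sliceAt A t')) :=
    sum_le_sum fun t' _ => eipValue_le _
  omega

end LowerBound

/-! ### Sorted stacks of a nested family, in every dimension ([MS20] Prop. 3.2, the set `C_s`) -/

section Stack

variable {n : ℕ}

/-- **The stack of the members `D(f k)` of a family `D` of subsets of `ℤ^n` in the hyperplanes
`x₀ = k`, `k < T`, of `ℤ^{n+1}`** (for a nested family and a non-increasing `f`: the decreasing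
rearrangement `C_s` of [MS20] Proposition 3.2 with its levels sorted; for the cubicles one dimension
down and the cubicle profile: the cubicle `⟦n⟧^{d}` of [AL13]).  Generalises `familyStack`
(`ℤ² → ℤ³`) of `CubicLatticeEdgeIsoperimetry.lean` to every dimension.
[cite: MaininiSchmidt2020, Proposition 3.2 (the decreasing rearrangement C_s); AgnarssonLauria2013, Definition 2.1 and Definition 5.8] -/
def famStack (D : ℕ → Finset (Site n)) (f : ℕ → ℕ) (T : ℕ) : Finset (Site (n + 1)) :=
  (range T).biUnion fun k => (D (f k)).image (Fin.cons (k : ℤ))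

variable {D : ℕ → Finset (Site n)} {f : ℕ → ℕ} {T : ℕ}

/-- Membership in a stack. [cite: MaininiSchmidt2020, Proposition 3.2 (C_s)] -/
theorem mem_famStack {x : Site (n + 1)} :
    x ∈ famStack D f T ↔ ∃ k, k < T ∧ x 0 = k ∧ Fin.tail x ∈ D (f k) := by
  simp only [famStack, mem_biUnion, mem_range, mem_image]
  constructor
  · rintro ⟨k, hk, y, hy, rfl⟩
    exact ⟨k, hk, by simp, by simpa using hy⟩
  · rintro ⟨k, hk, h0, hy⟩
    exact ⟨k, hk, Fin.tail x, hy, by rw [← h0, Fin.cons_self_tail]⟩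

/-- **Stacks over a nested family grow with the profile** (pointwise) and the height — the mechanism
by which nested profiles give nested solutions one dimension up ([AL13] Proposition 5.7,
`⟦n⟧^d ⊆ ⟦n'⟧^d` for `n ≤ n'`). [cite: AgnarssonLauria2013, Proposition 5.7] -/
theorem famStack_mono (hD : IsNestedMinimizerFamily D) {f g : ℕ → ℕ} (hfg : ∀ k, f k ≤ g k)
    {T T' : ℕ} (hT : T ≤ T') : famStack D f T ⊆ famStack D g T' := by
  intro x hx
  rw [mem_famStack] at hx ⊢
  obtain ⟨k, hk, h0, hy⟩ := hx
  exact ⟨k, lt_of_lt_of_le hk hT, h0, hD.mono (hfg k) hy⟩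

/-- The slice of a stack at height `k` is `D(f k)` (profile vanishing from `T` on).
[cite: MaininiSchmidt2020, Proposition 3.2 (sections of C_s are the daisies D_{s,k})] -/
theorem sliceAt_famStack_natCast (hD : IsNestedMinimizerFamily D) (hT : ∀ k, T ≤ k → f k = 0)
    (k : ℕ) : sliceAt (famStack D f T) (k : ℤ) = D (f k) := by
  ext y
  rw [mem_sliceAt, mem_famStack]
  constructor
  · rintro ⟨k', -, h0, hy⟩
    simp only [Fin.cons_zero, Nat.cast_inj] at h0
    subst h0
    simpa using hy
  · intro hy
    by_cases hk : k < T
    · exact ⟨k, hk, by simp, by simpa using hy⟩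
    · exfalso
      have h0 : D (f k) = ∅ := by
        rw [← card_eq_zero, hD.card_eq, hT k (Nat.le_of_not_lt hk)]
      rw [h0] at hy
      simp at hy

/-- Below the stack the slice is empty. [cite: MaininiSchmidt2020, Proposition 3.2] -/
theorem sliceAt_famStack_neg_one : sliceAt (famStack D f T) (-1) = ∅ := by
  refine eq_empty_of_forall_notMem fun y hy => ?_
  rw [mem_sliceAt, mem_famStack] at hy
  obtain ⟨k, -, h0, -⟩ := hy
  simp only [Fin.cons_zero] at h0
  omega

/-- The occupied heights of a stack with positive profile are `0, …, T − 1`.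
[cite: MaininiSchmidt2020, Proposition 3.2 (sections of C_s nonempty exactly for k = 1, …, #K_s)] -/
theorem firstCoords_famStack (hD : IsNestedMinimizerFamily D) (hpos : ∀ k, k < T → 0 < f k) :
    firstCoords (famStack D f T) = (range T).image (Nat.cast : ℕ → ℤ) := by
  ext t
  rw [firstCoords, mem_image, mem_image]
  constructor
  · rintro ⟨x, hx, rfl⟩
    obtain ⟨k, hk, h0, -⟩ := mem_famStack.1 hx
    exact ⟨k, mem_range.2 hk, h0.symm⟩
  · rintro ⟨k, hk, rfl⟩
    have hne : (D (f k)).Nonempty := by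
      rw [← card_pos, hD.card_eq]; exact hpos k (mem_range.1 hk)
    obtain ⟨y, hy⟩ := hne
    exact ⟨Fin.cons (k : ℤ) y, mem_famStack.2 ⟨k, mem_range.1 hk, by simp, by simpa using hy⟩,
      by simp⟩

/-- **A stack has `Σ_{k<T} f(k)` points.** [cite: MaininiSchmidt2020, Proposition 3.2 (#C_s = #C)] -/
theorem card_famStack (hD : IsNestedMinimizerFamily D) (f : ℕ → ℕ) (T : ℕ) :
    #(famStack D f T) = ∑ k ∈ range T, f k := by
  rw [famStack, card_biUnion]
  · refine sum_congr rfl fun k _ => ?_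
    rw [card_image_of_injective _ ((Fin.cons_injective2 (α := fun _ : Fin (n + 1) => ℤ)).right _),
      hD.card_eq]
  · intro k _ k' _ hkk'
    rw [Function.onFun, Finset.disjoint_left]
    intro x hx hx'
    obtain ⟨y, -, rfl⟩ := mem_image.1 hx
    obtain ⟨y', -, h⟩ := mem_image.1 hx'
    have h0 := congrFun h 0
    simp only [Fin.cons_zero, Nat.cast_inj] at h0
    exact hkk' h0.symm

/-- Telescoping for a non-increasing profile: `Σ_{k<T} (f k − f (k+1)) = f 0 − f T`.
[cite: MaininiSchmidt2020, Proposition 3.2 (proof: the vertical count Σ |f(k_i) − f(k_{i−1})|)] -/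
private theorem sum_range_tsub_succ (hf : Antitone f) (T : ℕ) :
    ∑ k ∈ range T, (f k - f (k + 1)) = f 0 - f T := by
  induction T with
  | zero => simp
  | succ T ih =>
    rw [sum_range_succ, ih]
    have h1 : f (T + 1) ≤ f T := hf (Nat.le_succ T)
    have h2 : f T ≤ f 0 := hf (Nat.zero_le T)
    omega

/-- **The edge perimeter of a sorted stack: `#Θ_{n+1}(famStack D f T) = 2·f(0) + Σ_{k<T} EIP^n(f k)`**
for a nested family of `EIP^n` minimizers `D` and a non-increasing profile `f`, positive below `T`
and vanishing at `T`: the slices contribute their optima and the vertical pairs telescope to twice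
the largest slice — [MS20] Proposition 3.2's count `Σ_k #Θ_{d−1}(D_{s,k}) + Σ |f(k_i) − f(k_{i−1})|`
evaluated on the sorted rearrangement, [AL13] Observation 3.1. [cite: MaininiSchmidt2020, Proposition 3.2; AgnarssonLauria2013, Observation 3.1] -/
theorem card_boundaryPairs_famStack (hD : IsNestedMinimizerFamily D)
    (hpos : ∀ k, k < T → 0 < f k) (hf : Antitone f) (hT : f T = 0) :
    #(boundaryPairs (famStack D f T)) = 2 * f 0 + ∑ k ∈ range T, eipValue n (f k) := by
  have hT' : ∀ k, T ≤ k → f k = 0 := fun k hk => Nat.le_zero.1 (hT ▸ hf hk)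
  have hinj : Set.InjOn (Nat.cast : ℕ → ℤ) ↑(range T) := fun a _ b _ h => by exact_mod_cast h
  rw [card_boundaryPairs_eq_sum_sliceAt_add (famStack D f T),
    card_vertBoundaryPairs_eq_sum (famStack D f T),
    card_vertBoundaryPairs_eq_sum (famStack D f T),
    firstCoords_famStack hD hpos, sum_image hinj, sum_image hinj, sum_image hinj]
  simp only [if_true, Bool.false_eq_true, if_false]
  have hs1 : ∑ k ∈ range T, #(boundaryPairs (sliceAt (famStack D f T) (k : ℤ))) =
      ∑ k ∈ range T, eipValue n (f k) := by
    refine sum_congr rfl fun k _ => ?_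
    rw [sliceAt_famStack_natCast hD hT', hD.card_boundaryPairs]
  have hs2 : ∑ k ∈ range T, #(sliceAt (famStack D f T) (k : ℤ) \
      sliceAt (famStack D f T) (k + 1)) = f 0 := by
    have : ∀ k ∈ range T, #(sliceAt (famStack D f T) (k : ℤ) \
        sliceAt (famStack D f T) (k + 1)) = f k - f (k + 1) := by
      intro k _
      rw [show (k : ℤ) + 1 = ((k + 1 : ℕ) : ℤ) by push_cast; ring,
        sliceAt_famStack_natCast hD hT', sliceAt_famStack_natCast hD hT', hD.card_sdiff]
    rw [sum_congr rfl this, sum_range_tsub_succ hf, hT, Nat.sub_zero]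
  have hs3 : ∑ k ∈ range T, #(sliceAt (famStack D f T) (k : ℤ) \
      sliceAt (famStack D f T) (k + -1)) = f 0 := by
    cases T with
    | zero => rw [sum_range_zero, hT]
    | succ S =>
      rw [sum_range_succ']
      have h0 : #(sliceAt (famStack D f (S + 1)) ((0 : ℕ) : ℤ) \
          sliceAt (famStack D f (S + 1)) ((0 : ℕ) + -1)) = f 0 := by
        rw [show ((0 : ℕ) : ℤ) + -1 = -1 by simp, sliceAt_famStack_neg_one, sdiff_empty,
          sliceAt_famStack_natCast hD hT', hD.card_eq]
      have h1 : ∀ k ∈ range S, #(sliceAt (famStack D f (S + 1)) ((k + 1 : ℕ) : ℤ) \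
          sliceAt (famStack D f (S + 1)) ((k + 1 : ℕ) + -1)) = 0 := by
        intro k _
        rw [show ((k + 1 : ℕ) : ℤ) + -1 = ((k : ℕ) : ℤ) by push_cast; ring,
          sliceAt_famStack_natCast hD hT', sliceAt_famStack_natCast hD hT', hD.card_sdiff]
        exact Nat.sub_eq_zero_of_le (hf (Nat.le_succ k))
      rw [sum_congr rfl h1, sum_const_zero, h0, zero_add]
  rw [hs1, hs2, hs3]
  ring

/-- The stack over a planar family recovers `familyStack` of `CubicLatticeEdgeIsoperimetry.lean`
(`famStack (n := 2) = familyStack`). [cite: AgnarssonLauria2013, Definition 5.8] -/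
theorem famStack_two_eq_familyStack (D : ℕ → Finset (Site 2)) (f : ℕ → ℕ) (T : ℕ) :
    famStack D f T = familyStack D f T := rfl

end Stack

/-! ### The sorted profile of a set ([MS20] Prop. 3.2: levels sorted by decreasing cardinality) -/

section Profile

variable {n : ℕ}

/-- Sorting finitely many natural numbers in non-increasing order: the values `g t`, `t ∈ S`, are
enumerated by a non-increasing `f : ℕ → ℕ` supported in `[0, #S)`, with the same distribution
(`Σ_k φ(f k) = Σ_t φ(g t)` for every `φ`).  (The reordering `σ` of [MS20] Proposition 3.2:
"`#S_{s,σ(k)}(C)`, `k = 1, …, #K_s`, non-increasing".) [cite: MaininiSchmidt2020, Proposition 3.2 (the permutation σ sorting the sections by cardinality)] -/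
theorem exists_antitone_enumeration {ι : Type*} (S : Finset ι) (g : ι → ℕ) :
    ∃ f : ℕ → ℕ, Antitone f ∧ (∀ k, #S ≤ k → f k = 0) ∧ (∀ k, f k ≤ S.sup g) ∧
      ∀ φ : ℕ → ℕ, ∑ k ∈ range #S, φ (f k) = ∑ t ∈ S, φ (g t) := by
  classical
  induction S using Finset.induction_on_max_value g with
  | empty =>
    exact ⟨fun _ => 0, fun _ _ _ => le_rfl, fun _ _ => rfl, fun _ => Nat.zero_le _, fun φ => by simp⟩
  | insert a s ha hmax ih =>
    obtain ⟨f, hf, hT, hsup, hsum⟩ := ih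
    have hsa : s.sup g ≤ g a := Finset.sup_le fun x hx => hmax x hx
    refine ⟨fun k => if k = 0 then g a else f (k - 1), ?_, ?_, ?_, ?_⟩
    · intro k k' hkk'
      dsimp only
      by_cases hk' : k' = 0
      · have hk : k = 0 := by omega
        simp [hk, hk']
      · rw [if_neg hk']
        by_cases hk : k = 0
        · rw [if_pos hk]; exact (hsup _).trans hsa
        · rw [if_neg hk]; exact hf (by omega)
    · intro k hk
      rw [card_insert_of_notMem ha] at hk
      dsimp only
      rw [if_neg (by omega)]
      exact hT _ (by omega)
    · intro k
      dsimp only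
      rw [sup_insert]
      split_ifs
      · exact le_sup_left
      · exact (hsup _).trans le_sup_right
    · intro φ
      rw [card_insert_of_notMem ha, sum_range_succ', sum_insert ha]
      simp only [Nat.add_one_ne_zero, if_false, Nat.add_sub_cancel, if_true, hsum φ]
      ring

/-- The first zero of a non-increasing profile: below it the profile is positive, from it on zero.
[cite: MaininiSchmidt2020, Proposition 3.2 (the nonempty sections K_s)] -/
theorem exists_support_of_antitone {f : ℕ → ℕ} (hf : Antitone f) {T : ℕ} (hT : f T = 0) :
    ∃ T₀, T₀ ≤ T ∧ (∀ k, k < T₀ → 0 < f k) ∧ ∀ k, T₀ ≤ k → f k = 0 := by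
  classical
  have hex : ∃ k, f k = 0 := ⟨T, hT⟩
  refine ⟨Nat.find hex, Nat.find_min' hex hT, fun k hk => Nat.pos_of_ne_zero (Nat.find_min hex hk),
    fun k hk => Nat.le_zero.1 ?_⟩
  rw [← Nat.find_spec hex]
  exact hf hk

/-- Sums of a non-increasing profile over `range T` only see the support (for `φ 0 = 0`).
[cite: MaininiSchmidt2020, Proposition 3.2] -/
theorem sum_range_eq_sum_range_of_support {f : ℕ → ℕ} {T₀ T : ℕ} (hT₀ : T₀ ≤ T)
    (hzero : ∀ k, T₀ ≤ k → f k = 0) (φ : ℕ → ℕ) (hφ : φ 0 = 0) :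
    ∑ k ∈ range T, φ (f k) = ∑ k ∈ range T₀, φ (f k) := by
  rw [← sum_range_add_sum_Ico _ hT₀]
  have : ∑ k ∈ Ico T₀ T, φ (f k) = 0 :=
    sum_eq_zero fun k hk => by rw [hzero k (mem_Ico.1 hk).1, hφ]
  rw [this, add_zero]

variable {D : ℕ → Finset (Site n)}

/-- A stack does not see the levels beyond the support of its (non-increasing) profile.
[cite: MaininiSchmidt2020, Proposition 3.2] -/
theorem famStack_eq_of_support (hD : IsNestedMinimizerFamily D) {f : ℕ → ℕ} {T₀ T : ℕ}
    (hT₀ : T₀ ≤ T) (hzero : ∀ k, T₀ ≤ k → f k = 0) : famStack D f T = famStack D f T₀ := by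
  ext x
  rw [mem_famStack, mem_famStack]
  constructor
  · rintro ⟨k, hk, h0, hy⟩
    refine ⟨k, ?_, h0, hy⟩
    by_contra hk₀
    have h : D (f k) = ∅ := by rw [← card_eq_zero, hD.card_eq, hzero k (Nat.le_of_not_lt hk₀)]
    rw [h] at hy
    simp at hy
  · rintro ⟨k, hk, h0, hy⟩
    exact ⟨k, lt_of_lt_of_le hk hT₀, h0, hy⟩

/-- **`#Θ_{n+1}(famStack D f T) = 2·f(0) + Σ_{k<T} EIP^n(f k)`** for every non-increasing profile `f`
with `f T = 0` (no positivity needed: empty levels sit on top and contribute nothing).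
[cite: MaininiSchmidt2020, Proposition 3.2; AgnarssonLauria2013, Observation 3.1] -/
theorem card_boundaryPairs_famStack' (hD : IsNestedMinimizerFamily D) {f : ℕ → ℕ} {T : ℕ}
    (hf : Antitone f) (hT : f T = 0) :
    #(boundaryPairs (famStack D f T)) = 2 * f 0 + ∑ k ∈ range T, eipValue n (f k) := by
  obtain ⟨T₀, hT₀, hpos, hzero⟩ := exists_support_of_antitone hf hT
  rw [famStack_eq_of_support hD hT₀ hzero, card_boundaryPairs_famStack hD hpos hf (hzero T₀ le_rfl),
    sum_range_eq_sum_range_of_support hT₀ hzero (eipValue n) (eipValue_zero_right n)]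

/-- `#(famStack D f T) = Σ_{k<T} f k` restated on the support. [cite: MaininiSchmidt2020, Proposition 3.2] -/
theorem card_famStack_of_support (hD : IsNestedMinimizerFamily D) {f : ℕ → ℕ} {T₀ T : ℕ}
    (hT₀ : T₀ ≤ T) (hzero : ∀ k, T₀ ≤ k → f k = 0) :
    #(famStack D f T₀) = ∑ k ∈ range T, f k := by
  rw [card_famStack hD]
  exact (sum_range_eq_sum_range_of_support hT₀ hzero id rfl).symm

variable (A : Finset (Site (n + 1)))

/-- `2·#(dropFirst A) + Σ_{t} EIP^n(#A_t) ≤ #Θ_{n+1}(A)` (the projection form of the slicing bound).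
[cite: MaininiSchmidt2020, Proposition 3.2 (proof)] -/
theorem two_mul_card_dropFirst_add_sum_eipValue_le :
    2 * #(dropFirst A) + ∑ t ∈ firstCoords A, eipValue n #(sliceAt A t) ≤ #(boundaryPairs A) := by
  have h1 := sum_card_boundaryPairs_sliceAt_add_le (A := A)
  have h3 : ∑ t' ∈ firstCoords A, eipValue n #(sliceAt A t') ≤
      ∑ t' ∈ firstCoords A, #(boundaryPairs (sliceAt A t')) :=
    sum_le_sum fun t' _ => eipValue_le _
  omega

/-- **The sorted profile of `A ⊂ ℤ^{n+1}`**: the slice cardinalities `#A_t` in non-increasing order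
form a profile `f` (supported in `[0, T)`, `T` the number of non-empty slices, positive there) with
`Σ f = #A`, every value a slice cardinality (so `≤ #(dropFirst A)`), `Σ_k EIP^n(f k) = Σ_t EIP^n(#A_t)`,
and COST `2 f(0) + Σ_k EIP^n(f k) ≤ #Θ_{n+1}(A)`.  With a nested family `D` in `ℤ^n`, `famStack D f T`
is then the decreasing rearrangement `C_s` of `A` of [MS20] Proposition 3.2, and the cost is its
edge perimeter. [cite: MaininiSchmidt2020, Proposition 3.2] -/
theorem exists_sortedProfile :
    ∃ (T : ℕ) (f : ℕ → ℕ), T = #(firstCoords A) ∧ Antitone f ∧ (∀ k, T ≤ k → f k = 0) ∧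
      (∀ k, k < T → 0 < f k) ∧ ∑ k ∈ range T, f k = #A ∧ (∀ k, f k ≤ #(dropFirst A)) ∧
      (∀ φ : ℕ → ℕ, ∑ k ∈ range T, φ (f k) = ∑ t ∈ firstCoords A, φ #(sliceAt A t)) ∧
      2 * f 0 + ∑ k ∈ range T, eipValue n (f k) ≤ #(boundaryPairs A) := by
  obtain ⟨f, hf, hT, hsup, hsum⟩ :=
    exists_antitone_enumeration (firstCoords A) fun t => #(sliceAt A t)
  have hsup' : (firstCoords A).sup (fun t => #(sliceAt A t)) ≤ #(dropFirst A) :=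
    Finset.sup_le fun t _ => card_sliceAt_le_card_dropFirst t
  refine ⟨#(firstCoords A), f, rfl, hf, hT, ?_, ?_, fun k => (hsup k).trans hsup', hsum, ?_⟩
  · intro k hk
    by_contra h0
    have h0' : f k = 0 := by omega
    have h1 := hsum fun v => if v = 0 then 1 else 0
    have h2 : ∑ t ∈ firstCoords A, (if #(sliceAt A t) = 0 then 1 else 0) = 0 :=
      sum_eq_zero fun t ht => by
        rw [if_neg]
        exact (card_pos.2 (sliceAt_nonempty ht)).ne'
    rw [h2] at h1
    have h3 := (sum_eq_zero_iff.1 h1) k (mem_range.2 hk)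
    rw [if_pos h0'] at h3
    exact one_ne_zero h3
  · rw [card_eq_sum_card_sliceAt (A := A)]
    exact hsum id
  · have h := two_mul_card_dropFirst_add_sum_eipValue_le A
    rw [← hsum (eipValue n)] at h
    have h0 := (hsup 0).trans hsup'
    omega

end Profile

/-! ### The recursion `EIP^{n+1}(N) = min {2·max f + Σ EIP^n(f k)}` over profiles of `N` -/

section Recursion

variable {n : ℕ} {D : ℕ → Finset (Site n)}

/-- The **cost** of a profile `f` supported in `[0, T)` over `ℤ^n`: `2·f(0) + Σ_{k<T} EIP^n(f k)` — the
edge perimeter of the sorted stack with levels of sizes `f 0 ≥ f 1 ≥ ⋯`.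
[cite: MaininiSchmidt2020, Proposition 3.2 (#Θ_d(C_s)); AgnarssonLauria2013, Observation 3.1] -/
def profileCost (n : ℕ) (f : ℕ → ℕ) (T : ℕ) : ℕ := 2 * f 0 + ∑ k ∈ range T, eipValue n (f k)

/-- Unfolding `profileCost`. [cite: MaininiSchmidt2020, Proposition 3.2] -/
theorem profileCost_def (n : ℕ) (f : ℕ → ℕ) (T : ℕ) :
    profileCost n f T = 2 * f 0 + ∑ k ∈ range T, eipValue n (f k) := rfl

/-- **Upper bound: every profile is realised.**  Given a nested family of `EIP^n` minimizers, for
every non-increasing profile `f` with `f T = 0`,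
`EIP^{n+1}(Σ_{k<T} f k) ≤ 2·f(0) + Σ_{k<T} EIP^n(f k)` — witnessed by the sorted stack `famStack D f T`
([MS20] Proposition 3.2: `#Θ_d(C_s) ≤ #Θ_d(C)`, read as an upper bound for the optimum).
[cite: MaininiSchmidt2020, Proposition 3.2; AgnarssonLauria2013, Observation 3.1] -/
theorem eipValue_succ_le_profileCost (hD : IsNestedMinimizerFamily D) {f : ℕ → ℕ} {T : ℕ}
    (hf : Antitone f) (hT : f T = 0) :
    eipValue (n + 1) (∑ k ∈ range T, f k) ≤ profileCost n f T := by
  have h := eipValue_le (famStack D f T)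
  rwa [card_famStack hD, card_boundaryPairs_famStack' hD hf hT] at h

/-- **Lower bound: every set costs at least its sorted profile**, `profileCost n f T ≤ #Θ_{n+1}(A)`
for the sorted profile `f` of `A` (restated from `exists_sortedProfile`); hence
`EIP^{n+1}(N) ≥ min over profiles`. [cite: MaininiSchmidt2020, Proposition 3.2; AgnarssonLauria2013, §4 eq. (rec-exact1)] -/
theorem exists_profileCost_le_card_boundaryPairs (A : Finset (Site (n + 1))) :
    ∃ (T : ℕ) (f : ℕ → ℕ), Antitone f ∧ (∀ k, T ≤ k → f k = 0) ∧ (∀ k, k < T → 0 < f k) ∧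
      ∑ k ∈ range T, f k = #A ∧ profileCost n f T ≤ #(boundaryPairs A) := by
  obtain ⟨T, f, -, hf, hT, hpos, hsum, -, -, hcost⟩ := exists_sortedProfile A
  exact ⟨T, f, hf, hT, hpos, hsum, hcost⟩

/-- Sets of every cardinality exist in `ℤ^{n+1}` (a column of `N` points), so `EIP^{n+1}(N)` is a
genuine minimum. [cite: MaininiSchmidt2020, §1 (EIP^d(n) is a minimum over n-point sets)] -/
theorem exists_card_eq_succ (n N : ℕ) : ∃ A : Finset (Site (n + 1)), #A = N := by
  refine ⟨(range N).image fun k : ℕ => (Fin.cons (k : ℤ) (0 : Site n) : Site (n + 1)), ?_⟩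
  rw [card_image_of_injective _ fun a b h => ?_, card_range]
  have h0 := congrFun h 0
  simpa using h0

/-- A minimizer of every cardinality exists in `ℤ^{n+1}`. [cite: MaininiSchmidt2020, §1] -/
theorem exists_isEIPMinimizer_card_eq (n N : ℕ) :
    ∃ A : Finset (Site (n + 1)), IsEIPMinimizer A ∧ #A = N := by
  obtain ⟨A₀, hA₀⟩ := exists_card_eq_succ n N
  obtain ⟨A, hA, hv⟩ := exists_card_boundaryPairs_eq_eipValue A₀
  refine ⟨A, isEIPMinimizer_iff_eipValue.2 ?_, hA.trans hA₀⟩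
  rw [hv, hA]

/-- **The minimum is attained by a profile**: for every `N` there is a non-increasing profile `f` of
`N` (positive on `[0,T)`, zero from `T` on) with `2·f(0) + Σ_{k<T} EIP^n(f k) = EIP^{n+1}(N)` — the
sorted profile of any `N`-point minimizer.  With `eipValue_succ_le_profileCost` this is the
recursion `EIP^{n+1}(N) = min_f profileCost n f` determining the edge-isoperimetric profile of
`ℤ^{n+1}` from that of `ℤ^n` (given nested minimizers in `ℤ^n`), [AL13] §4 in boundary form.
[cite: MaininiSchmidt2020, Proposition 3.2; AgnarssonLauria2013, §4 (eq. (rec-exact1), (S2-part))] -/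
theorem exists_profileCost_eq_eipValue_succ (hD : IsNestedMinimizerFamily D) (N : ℕ) :
    ∃ (T : ℕ) (f : ℕ → ℕ), Antitone f ∧ (∀ k, T ≤ k → f k = 0) ∧ (∀ k, k < T → 0 < f k) ∧
      ∑ k ∈ range T, f k = N ∧ profileCost n f T = eipValue (n + 1) N := by
  obtain ⟨A, hA, hN⟩ := exists_isEIPMinimizer_card_eq n N
  obtain ⟨T, f, hf, hT, hpos, hsum, hcost⟩ := exists_profileCost_le_card_boundaryPairs A
  refine ⟨T, f, hf, hT, hpos, hsum.trans hN, le_antisymm ?_ ?_⟩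
  · rw [hA.card_boundaryPairs_eq hN] at hcost
    exact hcost
  · rw [← hsum.trans hN]
    exact eipValue_succ_le_profileCost hD hf (hT T le_rfl)

/-- **A sorted stack with an optimal profile is a minimizer.** [cite: MaininiSchmidt2020, Proposition 3.2 with Theorem 2.2; AgnarssonLauria2013, §5 (E_d(n) = F_d(n))] -/
theorem isEIPMinimizer_famStack_of_cost (hD : IsNestedMinimizerFamily D) {f : ℕ → ℕ} {T : ℕ}
    (hf : Antitone f) (hT : f T = 0)
    (hcost : profileCost n f T ≤ eipValue (n + 1) (∑ k ∈ range T, f k)) :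
    IsEIPMinimizer (famStack D f T) := by
  rw [isEIPMinimizer_iff_eipValue, card_boundaryPairs_famStack' hD hf hT, card_famStack hD]
  exact le_antisymm hcost (eipValue_succ_le_profileCost hD hf hT)

/-- Stacks over a nested family are monotone in the profile (pointwise order), whatever the heights,
as long as the larger profile vanishes from its height on. [cite: AgnarssonLauria2013, Proposition 5.7] -/
theorem famStack_subset_famStack (hD : IsNestedMinimizerFamily D) {f g : ℕ → ℕ} {T T' : ℕ}
    (hfg : ∀ k, f k ≤ g k) (hT' : ∀ k, T' ≤ k → g k = 0) : famStack D f T ⊆ famStack D g T' := by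
  intro x hx
  rw [mem_famStack] at hx ⊢
  obtain ⟨k, hk, h0, hy⟩ := hx
  refine ⟨k, ?_, h0, hD.mono (hfg k) hy⟩
  by_contra hk'
  have hg : g k = 0 := hT' k (Nat.le_of_not_lt hk')
  have hf0 : f k = 0 := Nat.le_zero.1 (hg ▸ hfg k)
  have h : D (f k) = ∅ := by rw [← card_eq_zero, hD.card_eq, hf0]
  rw [h] at hy
  simp at hy

/-- **Lifting nested solutions one dimension up.**  Let `D` be a nested family of `EIP^n` minimizers
and `e N` (`N ∈ ℕ`) a CHAIN of optimal profiles: `e N` non-increasing, vanishing from `T N` on, of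
total `N`, of cost `EIP^{n+1}(N)`, and `e N ≤ e (N+1)` pointwise.  Then the stacks
`famStack D (e N) (T N)` are a nested family of `EIP^{n+1}` minimizers.  This is how the cubicles
`⟦N⟧^{n+1}` of [AL13] (nested by Proposition 5.7, optimal by Theorem 6.4) / the daisies of [MS20]
(Theorem 2.9: sections of daisies are daisies) yield nested solutions dimension by dimension; what it
leaves to prove in each dimension is arithmetic on profiles.
[cite: AgnarssonLauria2013, Proposition 5.7 and Theorem 6.4; MaininiSchmidt2020, Theorem 2.2] -/
theorem isNestedMinimizerFamily_famStack_of_chain (hD : IsNestedMinimizerFamily D)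
    (e : ℕ → ℕ → ℕ) (T : ℕ → ℕ) (hanti : ∀ N, Antitone (e N))
    (hT : ∀ N k, T N ≤ k → e N k = 0) (hsum : ∀ N, ∑ k ∈ range (T N), e N k = N)
    (hcost : ∀ N, profileCost n (e N) (T N) ≤ eipValue (n + 1) N)
    (hmono : ∀ N k, e N k ≤ e (N + 1) k) :
    IsNestedMinimizerFamily (fun N => famStack D (e N) (T N)) where
  card_eq N := by rw [card_famStack hD, hsum]
  mono := monotone_nat_of_le_succ fun N =>
    famStack_subset_famStack hD (hmono N) (hT (N + 1))
  isEIPMinimizer N :=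
    isEIPMinimizer_famStack_of_cost hD (hanti N) (hT N _ le_rfl) ((hsum N).symm ▸ hcost N)

end Recursion

/-! ### [AL13] Lemma 4.1 in boundary form: cutting off one slice of an arbitrary set -/

section Cut

variable {n : ℕ} {D : ℕ → Finset (Site n)}

/-- Re-indexing a sum after deleting the index `k₀`. [cite: AgnarssonLauria2013, §4 (the cut S = S₁ ∪ S₂)] -/
private theorem sum_range_skip {M : Type*} [AddCommMonoid M] (u : ℕ → M) (k₀ : ℕ) :
    ∀ r : ℕ, ∑ j ∈ range (k₀ + r), (if j < k₀ then u j else u (j + 1)) + u k₀ =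
      ∑ k ∈ range (k₀ + r + 1), u k
  | 0 => by
    rw [add_zero, sum_range_succ]
    congr 1
    exact sum_congr rfl fun j hj => if_pos (mem_range.1 hj)
  | r + 1 => by
    rw [← add_assoc, sum_range_succ, add_right_comm, sum_range_skip u k₀ r,
      sum_range_succ _ (k₀ + r + 1), if_neg (by omega)]

/-- **`EIP^{n+1}(#A − #A_t) + EIP^n(#A_t) ≤ #Θ_{n+1}(A)` for EVERY finite `A ⊂ ℤ^{n+1}` and every slice
`A_t = A ∩ {x₀ = t}`** (given nested `EIP^n` minimizers): delete the level of size `#A_t` from the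
sorted profile of `A`; what remains is a profile of `#A − #A_t` whose cost dropped by at least
`EIP^n(#A_t)`, and every profile's cost bounds `EIP^{n+1}` of its total from above.  This is [AL13]
eq. (rec-exact2) / Lemma 4.1, `E_d(n) ≤ E_d(n₁) + E_{d−1}(n₂) + n₂` for the cut of an optimal fully
nested set below its top side, in boundary form (`#Θ = 2d·# − 2E`: the `+ n₂` cancels) — where it
holds for arbitrary sets and arbitrary slices, with no nestedness hypothesis.
[cite: AgnarssonLauria2013, Lemma 4.1 and eq. (rec-exact2); MaininiSchmidt2020, Proposition 3.2] -/
theorem eipValue_sub_add_eipValue_le_card_boundaryPairs (hD : IsNestedMinimizerFamily D)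
    (A : Finset (Site (n + 1))) (t : ℤ) :
    eipValue (n + 1) (#A - #(sliceAt A t)) + eipValue n #(sliceAt A t) ≤ #(boundaryPairs A) := by
  classical
  by_cases ht : t ∈ firstCoords A
  swap
  · rw [sliceAt_eq_empty_of_not_mem A ht, card_empty, Nat.sub_zero, eipValue_zero_right, add_zero]
    exact eipValue_le A
  obtain ⟨T, f, -, hf, hT, -, hsum, -, hφ, hcost⟩ := exists_sortedProfile A
  set s := #(sliceAt A t) with hs
  -- the value `s` occurs in the sorted profile
  obtain ⟨k₀, hk₀, hfk₀⟩ : ∃ k₀, k₀ < T ∧ f k₀ = s := by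
    have h1 := hφ fun v => if v = s then 1 else 0
    have h2 : 0 < ∑ t' ∈ firstCoords A, (if #(sliceAt A t') = s then 1 else 0) :=
      sum_pos' (fun _ _ => Nat.zero_le _) ⟨t, ht, by rw [if_pos hs.symm]; exact Nat.one_pos⟩
    rw [← h1] at h2
    obtain ⟨k₀, hk₀, hne⟩ := exists_ne_zero_of_sum_ne_zero h2.ne'
    refine ⟨k₀, mem_range.1 hk₀, ?_⟩
    by_contra h
    rw [if_neg h] at hne
    exact hne rfl
  obtain ⟨r, rfl⟩ : ∃ r, T = k₀ + r + 1 := ⟨T - 1 - k₀, by omega⟩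
  -- the profile with the level `k₀` deleted
  set g : ℕ → ℕ := fun j => if j < k₀ then f j else f (j + 1) with hg
  have hga : Antitone g := by
    intro j j' hjj'
    simp only [hg]
    by_cases h1 : j < k₀
    · by_cases h2 : j' < k₀
      · rw [if_pos h1, if_pos h2]; exact hf hjj'
      · rw [if_pos h1, if_neg h2]; exact hf (by omega)
    · have h2 : ¬ j' < k₀ := fun h2 => h1 (lt_of_le_of_lt hjj' h2)
      rw [if_neg h1, if_neg h2]; exact hf (by omega)
  have hgT : g (k₀ + r) = 0 := by
    simp only [hg, if_neg (show ¬ (k₀ + r < k₀) by omega)]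
    exact hT _ le_rfl
  have hg0 : g 0 ≤ f 0 := by
    simp only [hg]
    split_ifs
    · exact le_rfl
    · exact hf (Nat.zero_le 1)
  have hgsum : ∑ j ∈ range (k₀ + r), g j + f k₀ = #A := by
    rw [← hsum]
    exact sum_range_skip f k₀ r
  have hgeip : ∑ j ∈ range (k₀ + r), eipValue n (g j) + eipValue n (f k₀) =
      ∑ k ∈ range (k₀ + r + 1), eipValue n (f k) := by
    have : ∀ j, eipValue n (g j) =
        if j < k₀ then eipValue n (f j) else eipValue n (f (j + 1)) := fun j => by
      simp only [hg]
      split_ifs <;> rfl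
    rw [sum_congr rfl fun j _ => this j]
    exact sum_range_skip (fun k => eipValue n (f k)) k₀ r
  have hup := eipValue_succ_le_profileCost hD hga hgT
  rw [profileCost_def] at hup
  have hAeq : #A - s = ∑ j ∈ range (k₀ + r), g j := by omega
  rw [hAeq, ← hfk₀]
  omega

/-- The same for **sections in every direction `e_s`**: `EIP^{n+1}(#A − #S_{s,k}(A)) + EIP^n(#S_{s,k}(A))
≤ #Θ_{n+1}(A)` (move `e_s` to the front by a coordinate permutation, which preserves cardinalities
and edge perimeters). [cite: AgnarssonLauria2013, Lemma 4.1 ("This can also be obtained by any cut perpendicular to any of the d coordinate axes"); MaininiSchmidt2020, Definition 2.11] -/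
theorem eipValue_sub_add_eipValue_le_of_latticeSection (hD : IsNestedMinimizerFamily D)
    (A : Finset (Site (n + 1))) (s : Fin (n + 1)) (k : ℤ) :
    eipValue (n + 1) (#A - #(latticeSection s k A)) + eipValue n #(latticeSection s k A) ≤
      #(boundaryPairs A) := by
  classical
  have h := eipValue_sub_add_eipValue_le_card_boundaryPairs hD
    (A.image (relabel (Fin.cycleRange s).symm)) k
  rwa [sliceAt_image_relabel_eq_latticeSection, card_image_of_injective _ (relabel_injective _),
    card_boundaryPairs_image_relabel] at h

/-- **For a minimizer: `EIP^{n+1}(N − #S) + EIP^n(#S) ≤ EIP^{n+1}(N)`** for every section `S` of every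
`N`-point `EIP^{n+1}` minimizer — the inequality through which [AL13] run their induction on `n + d`
(with `S` a smallest side, `#S ≤ N/(m_d + 1)`, Observation 6.1).
[cite: AgnarssonLauria2013, Lemma 4.1 and §6 (eq. (alpha), (beta))] -/
theorem IsEIPMinimizer.eipValue_sub_add_eipValue_le (hD : IsNestedMinimizerFamily D)
    {A : Finset (Site (n + 1))} (hA : IsEIPMinimizer A) (s : Fin (n + 1)) (k : ℤ) :
    eipValue (n + 1) (#A - #(latticeSection s k A)) + eipValue n #(latticeSection s k A) ≤
      eipValue (n + 1) #A := by
  have h := eipValue_sub_add_eipValue_le_of_latticeSection hD A s k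
  rwa [hA.card_boundaryPairs_eq rfl] at h

end Cut

/-! ### [AL13] Observation 6.1: a set with more than `m^{n+1}` points has a small section -/

section SmallSection

variable {d : ℕ}

/-- If `#A > m^d` then in some direction `A` meets at least `m + 1` hyperplanes (`h_i ≥ m_d + 1` for
some `i`). [cite: AgnarssonLauria2013, §6 (proof of Observation 6.1)] -/
theorem exists_succ_le_card_image_apply (A : Finset (Site d)) {m : ℕ} (hA : m ^ d < #A) :
    ∃ i : Fin d, m + 1 ≤ #(A.image fun x => x i) := by
  by_contra h
  push Not at h
  have h1 : ∏ i, #(A.image fun x => x i) ≤ m ^ d := by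
    calc ∏ i, #(A.image fun x => x i) ≤ m ^ #(univ : Finset (Fin d)) :=
          prod_le_pow_card _ _ _ fun i _ => Nat.le_of_lt_succ (h i)
      _ = m ^ d := by rw [card_univ, Fintype.card_fin]
  have h2 := card_le_prod_card_image_apply A
  omega

variable {n : ℕ}

/-- A section has as many points as the corresponding fibre `{x ∈ A : x_s = k}`.
[cite: MaininiSchmidt2020, Definition 2.11 (P is a bijection on the hyperplane {x_s = k})] -/
theorem card_latticeSection_eq_card_filter (s : Fin (n + 1)) (k : ℤ) (A : Finset (Site (n + 1))) :
    #(latticeSection s k A) = #(A.filter fun x => x s = k) := by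
  classical
  unfold latticeSection
  refine card_image_of_injOn fun x hx y hy h => ?_
  have hx' := (mem_filter.1 (mem_coe.1 hx)).2
  have hy' := (mem_filter.1 (mem_coe.1 hy)).2
  rw [← Fin.insertNth_self_removeNth s x, ← Fin.insertNth_self_removeNth s y, hx', hy']
  exact congrArg _ h

/-- The sections in direction `e_s` partition `A`: `Σ_k #S_{s,k}(A) = #A`.
[cite: MaininiSchmidt2020, Definition 2.11; AgnarssonLauria2013, §4 (the slices S_{2;i})] -/
theorem sum_card_latticeSection (s : Fin (n + 1)) (A : Finset (Site (n + 1))) :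
    ∑ k ∈ A.image (fun x => x s), #(latticeSection s k A) = #A := by
  classical
  rw [card_eq_sum_card_fiberwise (f := fun x : Site (n + 1) => x s) (s := A)
    (t := A.image fun x => x s) fun x hx => mem_image_of_mem _ hx]
  exact sum_congr rfl fun k _ => card_latticeSection_eq_card_filter s k A

/-- **[AL13] Observation 6.1 for arbitrary sets**: if `A ⊂ ℤ^{n+1}` has more than `m^{n+1}` points,
then in some direction `e_s` it has at least `m + 1` non-empty sections, so its smallest non-empty
section `S` in that direction satisfies `#S·(m + 1) ≤ #A` (for a fully nested set the top side;
here any set, the smallest section). [cite: AgnarssonLauria2013, Observation 6.1] -/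
theorem exists_latticeSection_card_mul_le (A : Finset (Site (n + 1))) {m : ℕ}
    (hA : m ^ (n + 1) < #A) :
    ∃ (s : Fin (n + 1)) (k : ℤ), (latticeSection s k A).Nonempty ∧
      #(latticeSection s k A) * (m + 1) ≤ #A := by
  classical
  obtain ⟨s, hs⟩ := exists_succ_le_card_image_apply A hA
  set P := A.image fun x => x s with hP
  have hPne : P.Nonempty := card_pos.1 (by omega)
  obtain ⟨k₀, hk₀, hmin⟩ := exists_min_image P (fun k => #(latticeSection s k A)) hPne
  refine ⟨s, k₀, ?_, ?_⟩
  · obtain ⟨x, hx, hxk⟩ := mem_image.1 hk₀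
    exact ⟨Fin.removeNth s x, mem_image_of_mem _ (mem_filter.2 ⟨hx, hxk⟩)⟩
  · calc #(latticeSection s k₀ A) * (m + 1) ≤ #(latticeSection s k₀ A) * #P :=
          Nat.mul_le_mul_left _ hs
      _ = ∑ k ∈ P, #(latticeSection s k₀ A) := by rw [sum_const, smul_eq_mul, mul_comm]
      _ ≤ ∑ k ∈ P, #(latticeSection s k A) := sum_le_sum fun k hk => hmin k hk
      _ = #A := sum_card_latticeSection s A

end SmallSection

/-! ### Low-dimensional values and the unconditional recursion `ℤ³ → ℤ⁴` -/

section Instances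

/-- `EIP¹(m) = 2` for `m ≥ 1` (intervals). [cite: MaininiSchmidt2020, §1 (d = 1: W_n is an interval)] -/
theorem eipValue_one {m : ℕ} (hm : 1 ≤ m) : eipValue 1 m = 2 := by
  rw [← (isEIPMinimizer_intervalConfig m).card_boundaryPairs_eq (card_intervalConfig m),
    card_boundaryPairs_intervalConfig hm]

/-- `EIP²(m) = 2⌈2√m⌉` (Harary–Harborth; the daisies). [cite: MaininiPiovanoSchmidtStefanelli2019, §2 (θ_d = 2⌈2√d⌉)] -/
theorem eipValue_two (m : ℕ) : eipValue 2 m = 2 * halfPerim m := by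
  rw [← (isEIPMinimizer_daisyOf m).card_boundaryPairs_eq (card_daisyOf m), card_boundaryPairs_daisyOf]

/-- `EIP³(m) = 2·G₃(m)` (Alonso–Cerf / Agnarsson–Lauria at `d = 3`; the cubicles).
[cite: AgnarssonLauria2013, Theorem 6.4 (d = 3); AlonsoCerf1996, Corollary 3.4] -/
theorem eipValue_three (m : ℕ) : eipValue 3 m = 2 * cubicEIP m := by
  rw [← (isEIPMinimizer_cubicle m).card_boundaryPairs_eq (card_cubicle m), card_boundaryPairs_cubicle]

/-- **The recursion `ℤ³ → ℤ⁴`, unconditionally** (nested solutions in `ℤ³` are the cubicles): for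
every non-increasing profile `f` with `f T = 0`, `EIP⁴(Σ_{k<T} f k) ≤ 2·f(0) + Σ_{k<T} 2G₃(f k)`.
[cite: AgnarssonLauria2013, §4 eq. (rec-exact2) and §5 (d = 4 over the 3-cubicles); MaininiSchmidt2020, Proposition 3.2] -/
theorem eipValue_four_le (f : ℕ → ℕ) {T : ℕ} (hf : Antitone f) (hT : f T = 0) :
    eipValue 4 (∑ k ∈ range T, f k) ≤ 2 * f 0 + ∑ k ∈ range T, 2 * cubicEIP (f k) := by
  have h := eipValue_succ_le_profileCost isNestedMinimizerFamily_cubicle hf hT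
  rw [profileCost_def] at h
  simp_rw [eipValue_three] at h
  exact h

/-- … and `EIP⁴(N)` IS `min_f (2·f(0) + Σ_k 2G₃(f k))` over the non-increasing profiles of `N`: the
minimum is attained. [cite: AgnarssonLauria2013, §4–§5 (d = 4); MaininiSchmidt2020, Proposition 3.2] -/
theorem exists_profile_eipValue_four (N : ℕ) :
    ∃ (T : ℕ) (f : ℕ → ℕ), Antitone f ∧ (∀ k, T ≤ k → f k = 0) ∧ (∀ k, k < T → 0 < f k) ∧
      ∑ k ∈ range T, f k = N ∧ 2 * f 0 + ∑ k ∈ range T, 2 * cubicEIP (f k) = eipValue 4 N := by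
  obtain ⟨T, f, hf, hT, hpos, hsum, hcost⟩ :=
    exists_profileCost_eq_eipValue_succ isNestedMinimizerFamily_cubicle N
  refine ⟨T, f, hf, hT, hpos, hsum, ?_⟩
  rw [profileCost_def] at hcost
  simp_rw [eipValue_three] at hcost
  exact hcost

/-- **What remains of [MS20] Theorem 2.2 at `d = 4` is arithmetic**: any chain `e N ≤ e (N+1)` of
non-increasing profiles of `N` minimising `2·f(0) + Σ_k 2G₃(f k)` yields a nested family of `EIP⁴`
minimizers (the stacks of cubicles of `ℤ³`), hence [MS20] Corollary 3.3 at `d = 5`, etc.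
[cite: AgnarssonLauria2013, Proposition 5.7 and Theorem 6.4 (d = 4); MaininiSchmidt2020, Theorem 2.2] -/
theorem isNestedMinimizerFamily_four_of_chain (e : ℕ → ℕ → ℕ) (T : ℕ → ℕ)
    (hanti : ∀ N, Antitone (e N)) (hT : ∀ N k, T N ≤ k → e N k = 0)
    (hsum : ∀ N, ∑ k ∈ range (T N), e N k = N)
    (hcost : ∀ N, 2 * e N 0 + ∑ k ∈ range (T N), 2 * cubicEIP (e N k) ≤ eipValue 4 N)
    (hmono : ∀ N k, e N k ≤ e (N + 1) k) :
    IsNestedMinimizerFamily (fun N => famStack cubicle (e N) (T N)) := by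
  refine isNestedMinimizerFamily_famStack_of_chain isNestedMinimizerFamily_cubicle e T hanti hT hsum
    (fun N => ?_) hmono
  rw [profileCost_def]
  simp_rw [eipValue_three]
  exact hcost N

/-- **The `∀ d` fact `MaininiSchmidt2020_cor33` REDUCED to nested families in `ℤ^n` for `n ≥ 1`**
(corrected form of `MaininiSchmidt2020_cor33_of_nested`, whose hypothesis also quantifies over
`n = 0`, where `ℤ⁰` is a single point and no family with `#(D m) = m` exists): sections with values in
`ℤ⁰` are minimizers trivially, and for `n ≥ 1` the nested family does it
(`IsNestedMinimizerFamily.isEIPMinimizer_latticeSection`).  With `intervalConfig`, `daisyOf`,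
`cubicle` this covers `d ≤ 4`; the general case awaits the arithmetic half of [AL13].
[cite: MaininiSchmidt2020, Corollary 3.3 with Theorem 2.2] -/
theorem MaininiSchmidt2020_cor33_of_nested'
    (h : ∀ n : ℕ, 1 ≤ n → ∃ D : ℕ → Finset (Site n), IsNestedMinimizerFamily D) :
    MaininiSchmidt2020_cor33 := by
  intro n C hC s k
  rcases Nat.eq_zero_or_pos n with rfl | hn
  · exact isEIPMinimizer_site_zero _
  · obtain ⟨D, hD⟩ := h n hn
    exact hD.isEIPMinimizer_latticeSection hC s k

/-- The nested families in dimensions `1, 2, 3` packaged for the reduction: what is missing for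
`MaininiSchmidt2020_cor33` is exactly a nested family of `EIP^n` minimizers for each `n ≥ 4`.
[cite: MaininiSchmidt2020, Theorem 2.2 (d ≤ 3)] -/
theorem exists_isNestedMinimizerFamily_of_le_three {n : ℕ} (h1 : 1 ≤ n) (h3 : n ≤ 3) :
    ∃ D : ℕ → Finset (Site n), IsNestedMinimizerFamily D := by
  interval_cases n
  · exact ⟨intervalConfig, isNestedMinimizerFamily_intervalConfig⟩
  · exact ⟨daisyOf, isNestedMinimizerFamily_daisyOf⟩
  · exact ⟨cubicle, isNestedMinimizerFamily_cubicle⟩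

end Instances

end Literature.MathematicalPhysics.StatisticalMechanics

end
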